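import Summits.HodgeConjecture.HodgeConjecture.Theses.AdelicCoherence
import Literature.AlgebraicGeometry.Motives.MotivatedCyclesLefschetzProofs

/-!
# Birth skeleton of piece P2 `MotivatedClassesAlgebraic` (MA) — line "B on number-field products + André's algorithm"

Two stubs and the kernel-checked composition `MotivatedClassesAlgebraic_of`:
* `stub_lefschetzB_numberFieldProducts` — GROTHENDIECK'S STANDARD CONJECTURE `B` (θ-form, `WeilCohomology.StandardConjectureB`)
  for the Betti theory `P.B.W` on PRODUCTS `X_ρ × Y_ρ'` of complex varieties defined over number fields (open; known for
  curves, surfaces, abelian varieties (Lieberman 1968, Kleiman 1968 §2 App.), flag varieties);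
* `stub_motivated_by_numberFieldAuxiliaries` — ANDRÉ'S SCOLIE 2.5 FOR `X_ρ`: every motivated class on `X_ρ` lies in the
  ℚ-span of the generators `pr_X* (α ∪ ⋆γ)` whose auxiliary variety is `Y_ρ'`, `Y` smooth projective over a number field
  `k'` with `ρ' : k' →+* ℂ` (André 1996 §2.5 Scolie p. 17: `A_mot(X_L) = A_mot(X_Ksep)`, Galois acting through a finite
  group; spread out and specialise the auxiliary data);
composition = ANDRÉ'S ALGORITHM RUN WITH `B` ONLY WHERE IT IS USED (proved here, adapting the tree's
`WeilCohomology.mem_ratAlgebraicClasses_of_isMotivatedClass`): `⋆γ` is rational-algebraic by Kleiman 1968 Prop 2.3 under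
`B(X_ρ × Y_ρ')` (`isRatInduced_of_isLefschetzStar`, hard Lefschetz from the pin), `α ∪ ⋆γ` is rational-algebraic,
`x = pr_X* (α ∪ ⋆γ)` by perfectness of the Poincaré pairing, and `pr_X*` preserves rational algebraic classes
(`pushforward_fst_mem_ratAlgebraicClasses`).
-/

set_option linter.dupNamespace false
set_option linter.unusedVariables false

namespace Summit.HodgeConjecture.HodgeConjecture.Cruxes.CoherentClassesAlgebraic.PiecesSplit.P2

open Literature.AlgebraicGeometry.Motives CategoryTheory MonoidalCategory CartesianMonoidalCategory

/-! ### §1 Stub statements as obligation nodes (by name); the piece as a named Prop (until the split lands it in the route) -/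

/-- The piece MA `MotivatedClassesAlgebraic`, verbatim (the composition concludes this name; after `route edit --split`
re-register against the route decl). -/
abbrev MotivatedClassesAlgebraic : Prop :=
  ∀ ⦃k : Type⦄ [Field k] [NumberField k] (ρ : k →+* ℂ) (P : PeriodRealization k), HodgeRiemannIStatement P.B → HodgeRiemannIIStatement P.B → P.B.W.HasHardLefschetz → ∀ ⦃n : ℕ⦄ ⦃X : SchemeOver k⦄, IsSmoothProjective n X → ∀ (hXρ : IsSmoothProjective n ((baseChangeHom ρ).obj X)) (p : ℕ), Submodule.span ℚ {x : P.B.W.obj ((baseChangeHom ρ).obj X) (2 * p) | ∃ (m : ℕ) (Y : SchemeOver ℂ) (_ : IsSmoothProjective m Y) (η : P.B.W.obj (((baseChangeHom ρ).obj X) ⊗ Y) 2) (_ : P.B.W.IsHyperplaneClass (((baseChangeHom ρ).obj X) ⊗ Y) η) (S : P.B.W.GradedOp (((baseChangeHom ρ).obj X) ⊗ Y) (((baseChangeHom ρ).obj X) ⊗ Y)) (_ : P.B.W.IsLefschetzStar (n + m) η S) (a b b' : ℕ) (_ : b + b' = n + m) (hab : a + b' = p + m) (α : P.B.W.obj (((baseChangeHom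 ρ).obj X) ⊗ Y) (2 * a)) (γ : P.B.W.obj (((baseChangeHom ρ).obj X) ⊗ Y) (2 * b)), α ∈ P.B.W.ratAlgebraicClasses (((baseChangeHom ρ).obj X) ⊗ Y) a ∧ γ ∈ P.B.W.ratAlgebraicClasses (((baseChangeHom ρ).obj X) ⊗ Y) b ∧ ∀ (q : ℕ) (hq : p + q = n) (y : P.B.W.obj ((baseChangeHom ρ).obj X) (2 * q)), P.B.W.cupPairing ((baseChangeHom ρ).obj X) n (2 * p) (2 * q) (by omega) x y = P.B.W.trace (((baseChangeHom ρ).obj X) ⊗ Y) (n + m) (P.B.W.cup (show 2 * (p + m) + 2 * q = 2 * (n + m) by omega) (P.B.W.cup (show 2 * a + 2 * b' = 2 * (p + m) by omega) α (S (2 * b) (2 * b') γ)) (P.B.W.pullback (fst ((baseChangeHom ρ).obj X) Y) (2 * q) y))} ≤ P.B.W.algebraicClasses ((baseChangeHom ρ).obj X) p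

/-- Statement of `stub_lefschetzB_numberFieldProducts`, verbatim. -/
abbrev Statement.stub_lefschetzB_numberFieldProducts : Prop :=
  ∀ ⦃k : Type⦄ [Field k] [NumberField k] (ρ : k →+* ℂ) (P : PeriodRealization k), HodgeRiemannIStatement P.B → HodgeRiemannIIStatement P.B → P.B.W.HasHardLefschetz → ∀ ⦃n : ℕ⦄ ⦃X : SchemeOver k⦄, IsSmoothProjective n X → ∀ (hXρ : IsSmoothProjective n ((baseChangeHom ρ).obj X)) (k' : Type) [Field k'] [NumberField k'] (ρ' : k' →+* ℂ) ⦃m : ℕ⦄ ⦃Y : SchemeOver k'⦄, IsSmoothProjective m Y → IsSmoothProjective m ((baseChangeHom ρ').obj Y) → ∀ (η : P.B.W.obj (((baseChangeHom ρ).obj X) ⊗ ((baseChangeHom ρ').obj Y)) 2), P.B.W.IsHyperplaneClass (((baseChangeHom ρ).obj X) ⊗ ((baseChangeHom ρ').obj Y)) η → P.B.W.StandardConjectureB (n + m) (((baseChangeHom ρ).obj X) ⊗ ((baseChangeHom ρ').obj Y)) η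

/-- Statement of `stub_motivated_by_numberFieldAuxiliaries`, verbatim. -/
abbrev Statement.stub_motivated_by_numberFieldAuxiliaries : Prop :=
  ∀ ⦃k : Type⦄ [Field k] [NumberField k] (ρ : k →+* ℂ) (P : PeriodRealization k), HodgeRiemannIStatement P.B → HodgeRiemannIIStatement P.B → P.B.W.HasHardLefschetz → ∀ ⦃n : ℕ⦄ ⦃X : SchemeOver k⦄, IsSmoothProjective n X → ∀ (hXρ : IsSmoothProjective n ((baseChangeHom ρ).obj X)) (p : ℕ), P.B.W.motivatedClasses n ((baseChangeHom ρ).obj X) p ≤ Submodule.span ℚ {x : P.B.W.obj ((baseChangeHom ρ).obj X) (2 * p) | ∃ (k' : Type) (_ : Field k') (_ : NumberField k') (ρ' : k' →+* ℂ) (m : ℕ) (Y : SchemeOver k') (_ : IsSmoothProjective m Y) (_ : IsSmoothProjective m ((baseChangeHom ρ').obj Y)) (η : P.B.W.obj (((baseChangeHom ρ).obj X) ⊗ ((baseChangeHom ρ').obj Y)) 2) (_ : P.B.W.IsHyperplaneClass (((baseChangeHom ρ).obj X) ⊗ ((baseChangeHom ρ').obj Y)) η) (S : P.B.W.GradedOp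 (((baseChangeHom ρ).obj X) ⊗ ((baseChangeHom ρ').obj Y)) (((baseChangeHom ρ).obj X) ⊗ ((baseChangeHom ρ').obj Y))) (_ : P.B.W.IsLefschetzStar (n + m) η S) (a b b' : ℕ) (_ : b + b' = n + m) (hab : a + b' = p + m) (α : P.B.W.obj (((baseChangeHom ρ).obj X) ⊗ ((baseChangeHom ρ').obj Y)) (2 * a)) (γ : P.B.W.obj (((baseChangeHom ρ).obj X) ⊗ ((baseChangeHom ρ').obj Y)) (2 * b)), α ∈ P.B.W.ratAlgebraicClasses (((baseChangeHom ρ).obj X) ⊗ ((baseChangeHom ρ').obj Y)) a ∧ γ ∈ P.B.W.ratAlgebraicClasses (((baseChangeHom ρ).obj X) ⊗ ((baseChangeHom ρ').obj Y)) b ∧ ∀ (q : ℕ) (hq : p + q = n) (y : P.B.W.obj ((baseChangeHom ρ).obj X) (2 * q)), P.B.W.cupPairing ((baseChangeHom ρ).obj X) n (2 * p) (2 * q) (by omega) x y = P.B.W.trace (((baseChangeHom ρ).obj X) ⊗ ((baseChangeHom ρ').obj Y)) (n + m) (P.B.W.cup (show 2 * (p + m) + 2 * q = 2 * (n + m) by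 omega) (P.B.W.cup (show 2 * a + 2 * b' = 2 * (p + m) by omega) α (S (2 * b) (2 * b') γ)) (P.B.W.pullback (fst ((baseChangeHom ρ).obj X) ((baseChangeHom ρ').obj Y)) (2 * q) y))}

/-! ### §2 Stubs (signatures written out) and §3 composition -/

/-- Stub 1 (standard conjecture `B`, θ-form, for products of number-field-definable complex varieties, Betti theory `P.B.W`).
[Grothendieck1969StandardConjectures; Kleiman1968AlgebraicCycles §2, Prop 2.3; Lieberman1968; Andre1996Motifs §0.3] -/
theorem stub_lefschetzB_numberFieldProducts :
    ∀ ⦃k : Type⦄ [Field k] [NumberField k] (ρ : k →+* ℂ) (P : PeriodRealization k), HodgeRiemannIStatement P.B → HodgeRiemannIIStatement P.B → P.B.W.HasHardLefschetz → ∀ ⦃n : ℕ⦄ ⦃X : SchemeOver k⦄, IsSmoothProjective n X → ∀ (hXρ : IsSmoothProjective n ((baseChangeHom ρ).obj X)) (k' : Type) [Field k'] [NumberField k'] (ρ' : k' →+* ℂ) ⦃m : ℕ⦄ ⦃Y : SchemeOver k'⦄, IsSmoothProjective m Y → IsSmoothProjective m ((baseChangeHom ρ').obj Y) → ∀ (η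 : P.B.W.obj (((baseChangeHom ρ).obj X) ⊗ ((baseChangeHom ρ').obj Y)) 2), P.B.W.IsHyperplaneClass (((baseChangeHom ρ).obj X) ⊗ ((baseChangeHom ρ').obj Y)) η → P.B.W.StandardConjectureB (n + m) (((baseChangeHom ρ).obj X) ⊗ ((baseChangeHom ρ').obj Y)) η := by
  sorry

/-- Stub 2 (André 1996 §2.5 Scolie for `X_ρ`: number-field-definable auxiliary varieties span the motivated classes).
[Andre1996Motifs §2.5 Scolie (p. 17), §2.1 Déf. 1; Deligne1982HodgeCycles 2.7, 2.9] -/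
theorem stub_motivated_by_numberFieldAuxiliaries :
    ∀ ⦃k : Type⦄ [Field k] [NumberField k] (ρ : k →+* ℂ) (P : PeriodRealization k), HodgeRiemannIStatement P.B → HodgeRiemannIIStatement P.B → P.B.W.HasHardLefschetz → ∀ ⦃n : ℕ⦄ ⦃X : SchemeOver k⦄, IsSmoothProjective n X → ∀ (hXρ : IsSmoothProjective n ((baseChangeHom ρ).obj X)) (p : ℕ), P.B.W.motivatedClasses n ((baseChangeHom ρ).obj X) p ≤ Submodule.span ℚ {x : P.B.W.obj ((baseChangeHom ρ).obj X) (2 * p) | ∃ (k' : Type) (_ : Field k') (_ : NumberField k') (ρ' : k' →+* ℂ) (m : ℕ) (Y : SchemeOver k') (_ : IsSmoothProjective m Y) (_ : IsSmoothProjective m ((baseChangeHom ρ').obj Y)) (η : P.B.W.obj (((baseChangeHom ρ).obj X) ⊗ ((baseChangeHom ρ').obj Y)) 2) (_ : P.B.W.IsHyperplaneClass (((baseChangeHom ρ).obj X) ⊗ ((baseChangeHom ρ').obj Y)) η) (S : P.B.W.GradedOp (((baseChangeHom ρ).obj X) ⊗ ((baseChangeHom ρ').obj Y)) (((baseChangeHom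 ρ).obj X) ⊗ ((baseChangeHom ρ').obj Y))) (_ : P.B.W.IsLefschetzStar (n + m) η S) (a b b' : ℕ) (_ : b + b' = n + m) (hab : a + b' = p + m) (α : P.B.W.obj (((baseChangeHom ρ).obj X) ⊗ ((baseChangeHom ρ').obj Y)) (2 * a)) (γ : P.B.W.obj (((baseChangeHom ρ).obj X) ⊗ ((baseChangeHom ρ').obj Y)) (2 * b)), α ∈ P.B.W.ratAlgebraicClasses (((baseChangeHom ρ).obj X) ⊗ ((baseChangeHom ρ').obj Y)) a ∧ γ ∈ P.B.W.ratAlgebraicClasses (((baseChangeHom ρ).obj X) ⊗ ((baseChangeHom ρ').obj Y)) b ∧ ∀ (q : ℕ) (hq : p + q = n) (y : P.B.W.obj ((baseChangeHom ρ).obj X) (2 * q)), P.B.W.cupPairing ((baseChangeHom ρ).obj X) n (2 * p) (2 * q) (by omega) x y = P.B.W.trace (((baseChangeHom ρ).obj X) ⊗ ((baseChangeHom ρ').obj Y)) (n + m) (P.B.W.cup (show 2 * (p + m) + 2 * q = 2 * (n + m) by omega) (P.B.W.cup (show 2 * a + 2 * b' = 2 * (p + m) by omega) α (S (2 * b) (2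 * b') γ)) (P.B.W.pullback (fst ((baseChangeHom ρ).obj X) ((baseChangeHom ρ').obj Y)) (2 * q) y))} := by
  sorry

/-- Composition (André's algorithm under `B` restricted to the products actually used; Kleiman 1968 Prop. 2.3):
the two stubs give the piece MA (conclusion = the piece statement verbatim). -/
theorem MotivatedClassesAlgebraic_of
    (hB : Statement.stub_lefschetzB_numberFieldProducts)
    (hdesc : Statement.stub_motivated_by_numberFieldAuxiliaries) :
    MotivatedClassesAlgebraic := by
  intro k _ _ ρ P hI hII hL n X hX hXρ p
  -- the inlined André span of the piece is `motivatedClasses` (definitional)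
  change P.B.W.motivatedClasses n ((baseChangeHom ρ).obj X) p ≤ _
  refine le_trans (hdesc ρ P hI hII hL hX hXρ p) (Submodule.span_le.mpr ?_)
  rintro x ⟨k', _, _, ρ', m, Y, hY, hYρ', η, hη, S, hS, a, b, b', hbb', hab, α, γ, hα, hγ, hproj⟩
  refine P.B.W.ratAlgebraicClasses_le_algebraicClasses _ p ?_
  -- abbreviations
  have hXY := IsSmoothProjective.tensor_holds hXρ hYρ'
  -- `⋆γ` is rational algebraic: Kleiman 1968 Prop. 2.3 under `B(X_ρ × Y_ρ', η)` and hard Lefschetz (the pin)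
  have hSγ : S (2 * b) (2 * b') γ ∈ P.B.W.ratAlgebraicClasses (((baseChangeHom ρ).obj X) ⊗ ((baseChangeHom ρ').obj Y)) b' := by
    obtain ⟨u, hu, hind⟩ := WeilCohomology.isRatInduced_of_isLefschetzStar
      (hB ρ P hI hII hL hX hXρ k' ρ' hY hYρ' η hη) hL hXY hη hS (2 * b) (2 * b') (2 * b) (2 * b') (by omega) (by omega)
    exact P.B.W.map_ratAlgebraicClasses_of_isInducedBy hXY hXY u _ _ _ hu hind γ hγ
  -- hence so is `z = α ∪ ⋆γ`
  have hz : P.B.W.cup (show 2 * a + 2 * b' = 2 * (p + m) by omega) α (S (2 * b) (2 * b') γ) ∈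
      P.B.W.ratAlgebraicClasses (((baseChangeHom ρ).obj X) ⊗ ((baseChangeHom ρ').obj Y)) (p + m) :=
    P.B.W.cup_mem_ratAlgebraicClasses hXY (by omega) _ _ hα hSγ
  -- above the top degree there is nothing to prove
  by_cases hp : n < p
  · haveI := P.B.W.subsingleton_obj hXρ (i := 2 * p) (by omega)
    rw [Subsingleton.elim x 0]
    exact zero_mem _
  obtain ⟨q, hq⟩ : ∃ q, p + q = n := ⟨n - p, by omega⟩
  have he : 2 * (p + m) + 2 * q = 2 * (n + m) := by omega
  have hd : 2 * p + 2 * q = 2 * n := by omega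
  -- `x` is the push-forward of `z` (perfectness of the Poincaré pairing + the projection formula `hproj`)
  have hxz : x = P.B.W.pushforward (N := n + m) hXρ (fst ((baseChangeHom ρ).obj X) ((baseChangeHom ρ').obj Y)) he hd
      (P.B.W.cup (show 2 * a + 2 * b' = 2 * (p + m) by omega) α (S (2 * b) (2 * b') γ)) := by
    haveI := P.B.W.isPerfPair_cupPairing hXρ (2 * p) (2 * q) hd
    refine (LinearMap.IsPerfPair.bijective_left (P.B.W.cupPairing ((baseChangeHom ρ).obj X) n (2 * p) (2 * q) hd)).1 ?_
    ext y
    rw [hproj q hq y, PreWeilCohomology.cupPairing, LinearMap.compr₂_apply, P.B.W.trace_cup_pushforward]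
  rw [hxz]
  exact WeilCohomology.pushforward_fst_mem_ratAlgebraicClasses hXρ hYρ' he hd hz

/-- The literal written-out form (same term): stub statements → the piece statement verbatim. -/
example :
    (∀ ⦃k : Type⦄ [Field k] [NumberField k] (ρ : k →+* ℂ) (P : PeriodRealization k), HodgeRiemannIStatement P.B → HodgeRiemannIIStatement P.B → P.B.W.HasHardLefschetz → ∀ ⦃n : ℕ⦄ ⦃X : SchemeOver k⦄, IsSmoothProjective n X → ∀ (hXρ : IsSmoothProjective n ((baseChangeHom ρ).obj X)) (k' : Type) [Field k'] [NumberField k'] (ρ' : k' →+* ℂ) ⦃m : ℕ⦄ ⦃Y : SchemeOver k'⦄, IsSmoothProjective m Y → IsSmoothProjective m ((baseChangeHom ρ').obj Y) → ∀ (η : P.B.W.obj (((baseChangeHom ρ).obj X) ⊗ ((baseChangeHom ρ').obj Y)) 2), P.B.W.IsHyperplaneClass (((baseChangeHom ρ).obj X) ⊗ ((baseChangeHom ρ').obj Y)) η → P.B.W.StandardConjectureB (n + m) (((baseChangeHom ρ).obj X) ⊗ ((baseChangeHom ρ').obj Y)) η) →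
    (∀ ⦃k : Type⦄ [Field k] [NumberField k] (ρ : k →+* ℂ) (P : PeriodRealization k), HodgeRiemannIStatement P.B → HodgeRiemannIIStatement P.B → P.B.W.HasHardLefschetz → ∀ ⦃n : ℕ⦄ ⦃X : SchemeOver k⦄, IsSmoothProjective n X → ∀ (hXρ : IsSmoothProjective n ((baseChangeHom ρ).obj X)) (p : ℕ), P.B.W.motivatedClasses n ((baseChangeHom ρ).obj X) p ≤ Submodule.span ℚ {x : P.B.W.obj ((baseChangeHom ρ).obj X) (2 * p) | ∃ (k' : Type) (_ : Field k') (_ : NumberField k') (ρ' : k' →+* ℂ) (m : ℕ) (Y : SchemeOver k') (_ : IsSmoothProjective m Y) (_ : IsSmoothProjective m ((baseChangeHom ρ').obj Y)) (η : P.B.W.obj (((baseChangeHom ρ).obj X) ⊗ ((baseChangeHom ρ').obj Y)) 2) (_ : P.B.W.IsHyperplaneClass (((baseChangeHom ρ).obj X) ⊗ ((baseChangeHom ρ').obj Y)) η) (S : P.B.W.GradedOp (((baseChangeHom ρ).obj X) ⊗ ((baseChangeHom ρ').obj Y)) (((baseChangeHom ρ).obj X) ⊗ ((baseChangeHom ρ').obj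 Y))) (_ : P.B.W.IsLefschetzStar (n + m) η S) (a b b' : ℕ) (_ : b + b' = n + m) (hab : a + b' = p + m) (α : P.B.W.obj (((baseChangeHom ρ).obj X) ⊗ ((baseChangeHom ρ').obj Y)) (2 * a)) (γ : P.B.W.obj (((baseChangeHom ρ).obj X) ⊗ ((baseChangeHom ρ').obj Y)) (2 * b)), α ∈ P.B.W.ratAlgebraicClasses (((baseChangeHom ρ).obj X) ⊗ ((baseChangeHom ρ').obj Y)) a ∧ γ ∈ P.B.W.ratAlgebraicClasses (((baseChangeHom ρ).obj X) ⊗ ((baseChangeHom ρ').obj Y)) b ∧ ∀ (q : ℕ) (hq : p + q = n) (y : P.B.W.obj ((baseChangeHom ρ).obj X) (2 * q)), P.B.W.cupPairing ((baseChangeHom ρ).obj X) n (2 * p) (2 * q) (by omega) x y = P.B.W.trace (((baseChangeHom ρ).obj X) ⊗ ((baseChangeHom ρ').obj Y)) (n + m) (P.B.W.cup (show 2 * (p + m) + 2 * q = 2 * (n + m) by omega) (P.B.W.cup (show 2 * a + 2 * b' = 2 * (p + m) by omega) α (S (2 * b) (2 * b') γ)) (P.B.W.pullback (fst ((baseChangeHom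 ρ).obj X) ((baseChangeHom ρ').obj Y)) (2 * q) y))}) →
    (∀ ⦃k : Type⦄ [Field k] [NumberField k] (ρ : k →+* ℂ) (P : PeriodRealization k), HodgeRiemannIStatement P.B → HodgeRiemannIIStatement P.B → P.B.W.HasHardLefschetz → ∀ ⦃n : ℕ⦄ ⦃X : SchemeOver k⦄, IsSmoothProjective n X → ∀ (hXρ : IsSmoothProjective n ((baseChangeHom ρ).obj X)) (p : ℕ), Submodule.span ℚ {x : P.B.W.obj ((baseChangeHom ρ).obj X) (2 * p) | ∃ (m : ℕ) (Y : SchemeOver ℂ) (_ : IsSmoothProjective m Y) (η : P.B.W.obj (((baseChangeHom ρ).obj X) ⊗ Y) 2) (_ : P.B.W.IsHyperplaneClass (((baseChangeHom ρ).obj X) ⊗ Y) η) (S : P.B.W.GradedOp (((baseChangeHom ρ).obj X) ⊗ Y) (((baseChangeHom ρ).obj X) ⊗ Y)) (_ : P.B.W.IsLefschetzStar (n + m) η S) (a b b' : ℕ) (_ : b + b' = n + m) (hab : a + b' = p + m) (α : P.B.W.obj (((baseChangeHom ρ).obj X) ⊗ Y) (2 * a)) (γ : P.B.W.obj (((baseChangeHom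 ρ).obj X) ⊗ Y) (2 * b)), α ∈ P.B.W.ratAlgebraicClasses (((baseChangeHom ρ).obj X) ⊗ Y) a ∧ γ ∈ P.B.W.ratAlgebraicClasses (((baseChangeHom ρ).obj X) ⊗ Y) b ∧ ∀ (q : ℕ) (hq : p + q = n) (y : P.B.W.obj ((baseChangeHom ρ).obj X) (2 * q)), P.B.W.cupPairing ((baseChangeHom ρ).obj X) n (2 * p) (2 * q) (by omega) x y = P.B.W.trace (((baseChangeHom ρ).obj X) ⊗ Y) (n + m) (P.B.W.cup (show 2 * (p + m) + 2 * q = 2 * (n + m) by omega) (P.B.W.cup (show 2 * a + 2 * b' = 2 * (p + m) by omega) α (S (2 * b) (2 * b') γ)) (P.B.W.pullback (fst ((baseChangeHom ρ).obj X) Y) (2 * q) y))} ≤ P.B.W.algebraicClasses ((baseChangeHom ρ).obj X) p) :=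
  MotivatedClassesAlgebraic_of

/-- The piece from the two stubs. -/
theorem motivatedClassesAlgebraic : MotivatedClassesAlgebraic :=
  MotivatedClassesAlgebraic_of stub_lefschetzB_numberFieldProducts stub_motivated_by_numberFieldAuxiliaries

end Summit.HodgeConjecture.HodgeConjecture.Cruxes.CoherentClassesAlgebraic.PiecesSplit.P2
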